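import Literature.NumberTheory.EllipticCurves.NeronComponentIndexTypeIVPoints
import Literature.NumberTheory.EllipticCurves.LocalIndexThreeClasses
import HarnessLib

/-!
# The local index for type `IV`: `c_v ∈ {1, 3}` (proof)

Discharge of the named fact
`Literature.NumberTheory.EllipticCurves.localTamagawaNumber_of_kodairaSymbolAt_eq_IV`
(`NeronComponentIndex.lean`; Silverman, *ATAEC*, IV.9.4 Step 5, PDF p. 344: "Type IV, `m = 3`,
`f = v(Δ) − 2`, `c = 3` if `k' = k`, `c = 1` if `k' ≠ k`", `k'` the splitting field of
`T² + a₃,₁T − a₆,₂`), in the recorded form `c_v = 1 ∨ c_v = 3`, by the elementary tools of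
`LocalIndexBadPoints.lean`, `LocalIndexThreeClasses.lean` and the coordinate computations of
`NeronComponentIndexTypeIVPoints.lean`; no Néron model and no Hensel lifting.

## Proof

Let `R` be a discrete valuation ring with perfect residue field `k`, `I` an equation over `R`
for which Tate's algorithm stops at Step 5.

1. *Normal form* (`exists_smul_of_kodairaSymbolOfMinimal_eq_IV`): as for type `III` (Step-2
   translation, then `y ↦ y + sx`), `J = D • I` has `a₁, a₂, a₃ ∈ 𝔪`, `a₆ ∈ 𝔪²`, `π³ ∣ b₈`
   (Step 4 failed), hence `a₄ ∈ 𝔪²`, and `π³ ∤ b₆` (Step 5): writing `a₃ = πγ`, `a₆ = π²ε`, the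
   quadratic `Y² + γ̄Y − ε̄` has two distinct roots `r₁ ≠ r₂` in `k̄` (`γ̄² + 4ε̄ ≠ 0`).
2. *Bad points* are `(πx₁, πy₁)` with `ȳ₁² + γ̄ȳ₁ − ε̄ = 0` (the equation divided by `π²`), i.e.
   `ȳ₁ ∈ {r₁, r₂}` — the label. Negation sends `ȳ₁` to `−ȳ₁ − γ̄`, the other root
   (`neg_eq_some_IV`). For two bad points with the same label, `D = π·(2ȳ₁ + γ̄ + …)` is `π` times a
   unit and `π² ∣ N`, so the slope is `λ = N/D ∈ 𝔪` and `P + P' = (πX, πY)` with `Ȳ = −ȳ₁ − γ̄`: a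
   bad point with the other label (`add_eq_some_IV`).
3. If there is no bad point, the index is `1`; otherwise `LocalIndex.index_eq_three_of_cls`
   gives index `3`. The index is the same for `I` (`index_nonsingularReductionSubgroup_smul`),
   and this is `c_v` at a place `v`.

## References

* J. H. Silverman, *Advanced Topics in the Arithmetic of Elliptic Curves*, GTM 151, Springer
  1994, IV.9.4 Step 5 (PDF p. 344) and its proof (PDF pp. 348–349; Fig. 4.4: three rational
  curves through one point). [SilvermanATAEC1994]
-/

noncomputable section

open scoped Classical

open IsLocalRing

namespace Literature.NumberTheory.EllipticCurves

namespace LocalIndex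

open DiophantineGeometry DiophantineGeometry.TateAlgorithm

variable {R : Type*} [CommRing R] [IsDomain R] [IsDiscreteValuationRing R]

/-! ### Step 5 fired: the normal form -/

/-- Tate's tree returns `IV` exactly when the first four tests fail and the fifth fires.
[folklore] -/
theorem tateTree_eq_IV_iff (p1 p2 p3 p4 p5 : Prop) [Decidable p1] [Decidable p2]
    [Decidable p3] [Decidable p4] [Decidable p5] (n : ℕ) (rest : KodairaSymbol)
    (hrest : rest ≠ .IV) :
    (if p1 then KodairaSymbol.I 0 else if p2 then .I n else if p3 then .II else if p4 then .III
      else if p5 then .IV else rest) = .IV ↔ ¬ p1 ∧ ¬ p2 ∧ ¬ p3 ∧ ¬ p4 ∧ p5 := by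
  split_ifs <;> simp [*]

/-- The part of Tate's tree after Step 5 never returns `IV`. [folklore] -/
theorem tateTree_ne_IV (p6 p7 p8 p9 p10 : Prop) [Decidable p6] [Decidable p7] [Decidable p8]
    [Decidable p9] [Decidable p10] (n : ℕ) :
    (if p6 then KodairaSymbol.Istar 0 else if p7 then .Istar n else if p8 then .IVstar
      else if p9 then .IIIstar else if p10 then .IIstar else .I 0) ≠ .IV := by
  split_ifs <;> simp

/-- **Step 5 fired.** `kodairaSymbolOfMinimal V = IV` iff `π ∣ Δ` and, on the Step-2 model,
`π ∣ b₂`, `π² ∣ a₆`, `π³ ∣ b₈`, `π³ ∤ b₆`. [folklore] -/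
theorem kodairaSymbolOfMinimal_eq_IV_iff (V : WeierstrassCurve R) :
    V.kodairaSymbolOfMinimal = .IV ↔
      ¬ V.Δ ∉ maximalIdeal R ∧ ¬ (normalizeStep2 V).b₂ ∉ maximalIdeal R ∧
      ¬ (normalizeStep2 V).a₆ ∉ maximalIdeal R ^ 2 ∧
      ¬ (normalizeStep2 V).b₈ ∉ maximalIdeal R ^ 3 ∧
      (normalizeStep2 V).b₆ ∉ maximalIdeal R ^ 3 := by
  unfold WeierstrassCurve.kodairaSymbolOfMinimal
  exact tateTree_eq_IV_iff _ _ _ _ _ _ _ (tateTree_ne_IV _ _ _ _ _ _)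

/-- **The normal form of type `IV`.** Over a perfect residue field, if Tate's algorithm returns
`IV` then some `R`-model `D • V` has `a₁, a₂, a₃ ∈ 𝔪`, `a₄, a₆ ∈ 𝔪²` and `π³ ∤ b₆` (Step-2
translation and `y ↦ y + sx` as for type `III`; then `b₈ ≡ −a₄² (mod 𝔪³)` turns the failed
Step-4 test into `π² ∣ a₄`; Silverman, *ATAEC*, IV.9.4 Steps 4–5; cf. PDF p. 368: "`v(a₂) ≥ 1`,
`v(a₄) ≥ 2`, `v(a₆) = 2`" for the Type-IV case of Ogg's formula).
[cite: SilvermanATAEC1994, IV.9.4 Step 5] -/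
theorem exists_smul_of_kodairaSymbolOfMinimal_eq_IV [PerfectField (ResidueField R)]
    (V : WeierstrassCurve R) (hV : V.kodairaSymbolOfMinimal = .IV) :
    ∃ D : WeierstrassCurve.VariableChange R,
      (D • V).a₁ ∈ maximalIdeal R ∧ (D • V).a₂ ∈ maximalIdeal R ∧ (D • V).a₃ ∈ maximalIdeal R ∧
      (D • V).a₄ ∈ maximalIdeal R ^ 2 ∧ (D • V).a₆ ∈ maximalIdeal R ^ 2 ∧
      (D • V).b₆ ∉ maximalIdeal R ^ 3 := by
  have hϖ : Irreducible (uniformizer R) := irreducible_uniformizer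
  obtain ⟨h1, h2, h3, h4, h5⟩ := (kodairaSymbolOfMinimal_eq_IV_iff V).mp hV
  rw [not_not] at h1 h2 h3 h4
  -- Step 2
  have hex2 := exists_variableChange_step2_of_perfectField V h1
  have hN2 : normalizeStep2 V = hex2.choose • V := dif_pos hex2
  obtain ⟨-, hA₃, hA₄, -⟩ := hex2.choose_spec
  rw [hN2] at h2 h3 h4 h5
  set W₂ := hex2.choose • V with hW₂
  -- `y ↦ y + s x`
  have hres : residue R W₂.a₁ ^ 2 + 4 * residue R W₂.a₂ = 0 := by
    have := (residue_eq_zero_iff _).mpr h2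
    rwa [WeierstrassCurve.b₂, map_add, map_pow, map_mul, map_ofNat] at this
  obtain ⟨σ, h1σ, h2σ⟩ := exists_root_step6 _ _ hres
  obtain ⟨s, rfl⟩ := residue_surjective σ
  set C : WeierstrassCurve.VariableChange R := ⟨1, 0, s, 0⟩ with hC
  have e₁ : (C • W₂).a₁ = W₂.a₁ + 2 * s := by
    rw [WeierstrassCurve.variableChange_a₁, hC]; simp
  have e₂ : (C • W₂).a₂ = W₂.a₂ - s * W₂.a₁ - s ^ 2 := by
    rw [WeierstrassCurve.variableChange_a₂, hC]; simp
  have e₃ : (C • W₂).a₃ = W₂.a₃ := by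
    rw [WeierstrassCurve.variableChange_a₃, hC]; simp
  have e₄ : (C • W₂).a₄ = W₂.a₄ - s * W₂.a₃ := by
    rw [WeierstrassCurve.variableChange_a₄, hC]; simp
  have e₆ : (C • W₂).a₆ = W₂.a₆ := by
    rw [WeierstrassCurve.variableChange_a₆, hC]; simp
  have e₈ : (C • W₂).b₈ = W₂.b₈ := by
    rw [WeierstrassCurve.variableChange_b₈, hC]; simp
  have eb₆ : (C • W₂).b₆ = W₂.b₆ := by
    rw [WeierstrassCurve.variableChange_b₆, hC]; simp
  have hB₁ : (C • W₂).a₁ ∈ maximalIdeal R := by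
    rw [e₁, ← residue_eq_zero_iff, map_add, map_mul, map_ofNat]; exact h1σ
  have hB₂ : (C • W₂).a₂ ∈ maximalIdeal R := by
    rw [e₂, ← residue_eq_zero_iff, map_sub, map_sub, map_mul, map_pow]
    linear_combination (-1 : ResidueField R) * h2σ
  have hB₃ : (C • W₂).a₃ ∈ maximalIdeal R := e₃ ▸ hA₃
  have hB₄ : (C • W₂).a₄ ∈ maximalIdeal R := e₄ ▸ Ideal.sub_mem _ hA₄ (Ideal.mul_mem_left _ _ hA₃)
  have hB₆ : (C • W₂).a₆ ∈ maximalIdeal R ^ 2 := e₆ ▸ h3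
  have hB₈ : (C • W₂).b₈ ∈ maximalIdeal R ^ 3 := e₈ ▸ h4
  -- `π² ∣ a₄` from `π³ ∣ b₈ ≡ -a₄²`
  have hsq : (C • W₂).a₄ ^ 2 ∈ maximalIdeal R ^ 3 := by
    have hb₈ : (C • W₂).a₄ ^ 2 = (C • W₂).a₁ ^ 2 * (C • W₂).a₆ + 4 * (C • W₂).a₂ * (C • W₂).a₆ -
        (C • W₂).a₁ * (C • W₂).a₃ * (C • W₂).a₄ + (C • W₂).a₂ * (C • W₂).a₃ ^ 2 -
        (C • W₂).b₈ := by
      rw [WeierstrassCurve.b₈]; ring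
    rw [hb₈]
    have h22 : maximalIdeal R ^ 2 * maximalIdeal R ^ 2 ≤ maximalIdeal R ^ 3 := by
      rw [← pow_add]; exact Ideal.pow_le_pow_right (by norm_num)
    have h12 : maximalIdeal R * maximalIdeal R ^ 2 ≤ maximalIdeal R ^ 3 := by rw [← pow_succ']
    have h111 : maximalIdeal R * maximalIdeal R * maximalIdeal R ≤ maximalIdeal R ^ 3 := by
      rw [pow_succ, pow_two]
    refine Ideal.sub_mem _ (Ideal.add_mem _ (Ideal.sub_mem _ (Ideal.add_mem _ ?_ ?_) ?_) ?_) hB₈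
    · exact h22 (Ideal.mul_mem_mul (Ideal.pow_mem_pow hB₁ 2) hB₆)
    · exact h12 (Ideal.mul_mem_mul (Ideal.mul_mem_left _ _ hB₂) hB₆)
    · exact h111 (Ideal.mul_mem_mul (Ideal.mul_mem_mul hB₁ hB₃) hB₄)
    · exact h111 (Ideal.mul_mem_mul (Ideal.mul_mem_mul hB₂ hB₃) hB₃) |> fun h => by
        rwa [pow_two, ← mul_assoc]
  have hB₄' : (C • W₂).a₄ ∈ maximalIdeal R ^ 2 := by
    rw [mem_maximalIdeal_pow_iff_dvd] at hsq ⊢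
    exact pow_succ_dvd_of_pow_dvd_sq hϖ (k := 1) hsq
  refine ⟨C * hex2.choose, ?_⟩
  rw [mul_smul]
  exact ⟨hB₁, hB₂, hB₃, hB₄', hB₆, eb₆ ▸ h5⟩

variable {K : Type*} [Field K] [Algebra R K] [IsFractionRing R K]

/-! ### The index for the normal form -/

/-- **`[E(K) : E₀(K)] ∈ {1, 3}` for the normal form of type `IV`** (`a₁, a₂, a₃ ∈ 𝔪`,
`a₄, a₆ ∈ 𝔪²`, `π³ ∤ b₆`): if some point has singular reduction, label the bad points by the
root `ȳ₁ ∈ {r₁, r₂}` and apply `LocalIndex.index_eq_three_of_cls`; otherwise the index is `1`.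
[cite: SilvermanATAEC1994, IV.9.4 Step 5] -/
theorem index_mem_of_normalForm_IV (J : WeierstrassCurve R) (h1 : J.a₁ ∈ maximalIdeal R)
    (h2 : J.a₂ ∈ maximalIdeal R) (h3 : J.a₃ ∈ maximalIdeal R) (h4 : J.a₄ ∈ maximalIdeal R ^ 2)
    (h6 : J.a₆ ∈ maximalIdeal R ^ 2) (hb₆ : J.b₆ ∉ maximalIdeal R ^ 3) :
    (J.nonsingularReductionSubgroup (integers_valuationRing_valuation R K)).index = 1 ∨
      (J.nonsingularReductionSubgroup (integers_valuationRing_valuation R K)).index = 3 := by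
  have hϖ : Irreducible (uniformizer R) := irreducible_uniformizer
  set ϖ := uniformizer R with hϖdef
  set H := J.nonsingularReductionSubgroup (integers_valuationRing_valuation R K) with hH
  have hres0 : residue R ϖ = 0 :=
    (residue_eq_zero_iff _).mpr ((IsLocalRing.mem_maximalIdeal _).mpr hϖ.not_isUnit)
  obtain ⟨α, hα⟩ := mem_maximalIdeal_iff_dvd.mp h1
  obtain ⟨β, hβ⟩ := mem_maximalIdeal_iff_dvd.mp h2
  obtain ⟨γ, hγ⟩ := mem_maximalIdeal_iff_dvd.mp h3
  obtain ⟨δ, hδ⟩ := mem_maximalIdeal_pow_iff_dvd.mp h4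
  obtain ⟨ε, hε⟩ := mem_maximalIdeal_pow_iff_dvd.mp h6
  have hdisc : residue R γ ^ 2 + 4 * residue R ε ≠ 0 := by
    intro h0
    apply hb₆
    rw [mem_maximalIdeal_pow_iff_dvd, WeierstrassCurve.b₆, hγ, hε]
    have : ϖ ∣ γ ^ 2 + 4 * ε := by
      rw [← mem_maximalIdeal_iff_dvd, ← residue_eq_zero_iff, map_add, map_mul, map_pow, map_ofNat]
      exact h0
    obtain ⟨c, hc⟩ := this
    exact ⟨c, by linear_combination ϖ ^ 2 * hc⟩
  have h3' : J.a₃ ∈ maximalIdeal R := h3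
  have h4' : J.a₄ ∈ maximalIdeal R := Ideal.pow_le_self two_ne_zero h4
  have h6' : J.a₆ ∈ maximalIdeal R := Ideal.pow_le_self two_ne_zero h6
  -- no bad point: index one
  by_cases hex : ∃ P : (J.baseChange K).toAffine.Point, ¬ J.HasNonsingularReduction P
  swap
  · left
    rw [AddSubgroup.index_eq_one, eq_top_iff]
    exact fun P _ => (WeierstrassCurve.mem_nonsingularReductionSubgroup_iff _).mpr
      (not_not.mp fun h => hex ⟨P, h⟩)
  right
  obtain ⟨P₀, hP₀⟩ := hex
  -- coordinates of bad points and the label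
  have hbad : ∀ P : (J.baseChange K).toAffine.Point, ¬ J.HasNonsingularReduction P →
      ∃ (x₁ y₁ : R) (h : (J.baseChange K).toAffine.Nonsingular (algebraMap R K (ϖ * x₁))
        (algebraMap R K (ϖ * y₁))), P = .some _ _ h ∧
          residue R y₁ ^ 2 + residue R γ * residue R y₁ - residue R ε = 0 := by
    intro P hP
    obtain ⟨x₁, y₁, h, rfl, hid⟩ :=
      exists_eq_some_of_not_hasNonsingularReduction_IV J hϖ hα hβ hγ hδ hε hP
    refine ⟨x₁, y₁, h, rfl, ?_⟩
    have := congrArg (residue R) hid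
    simpa [hres0] using this
  choose! fx fy fh hPeq hfroot using hbad
  set r₁ := residue R (fy P₀) with hr₁def
  have hr₁ := hfroot P₀ hP₀
  -- `fy` is determined by the point
  have hfy : ∀ (x₁ y₁ : R) (h : (J.baseChange K).toAffine.Nonsingular (algebraMap R K (ϖ * x₁))
      (algebraMap R K (ϖ * y₁))), ¬ J.HasNonsingularReduction (.some _ _ h) →
        fy (.some _ _ h) = y₁ := by
    intro x₁ y₁ h hP
    have e := hPeq _ hP
    simp only [WeierstrassCurve.Affine.Point.some.injEq] at e
    exact (mul_left_cancel₀ hϖ.ne_zero (IsFractionRing.injective R K e.2)).symm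
  have hroot : ∀ P, ¬ J.HasNonsingularReduction P →
      residue R (fy P) = r₁ ∨ residue R (fy P) = -r₁ - residue R γ :=
    fun P hP => root_quadratic_eq_or (hfroot P hP) hr₁
  have hsimple : ∀ P, ¬ J.HasNonsingularReduction P →
      2 * residue R (fy P) + residue R γ ≠ 0 :=
    fun P hP => two_mul_add_ne_zero_of_root (hfroot P hP) hdisc
  have hr₁₂ : -r₁ - residue R γ ≠ r₁ := by
    intro h
    apply two_mul_add_ne_zero_of_root hr₁ hdisc
    linear_combination -h
  -- the label and its flip
  set cls : (J.baseChange K).toAffine.Point → Bool := fun P => decide (residue R (fy P) = r₁)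
    with hcls
  have hflip : ∀ ρ : ResidueField R, (ρ = r₁ ∨ ρ = -r₁ - residue R γ) →
      decide (-ρ - residue R γ = r₁) = !decide (ρ = r₁) := by
    rintro ρ (rfl | rfl)
    · simp [hr₁₂]
    · have e : -(-r₁ - residue R γ) - residue R γ = r₁ := by ring
      rw [e]
      simp [hr₁₂]
  have hbadpt : ∀ (x₁ y₁ : R) (h : (J.baseChange K).toAffine.Nonsingular
      (algebraMap R K (ϖ * x₁)) (algebraMap R K (ϖ * y₁))),
      ¬ J.HasNonsingularReduction (.some _ _ h) := by
    intro x₁ y₁ h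
    exact not_hasNonsingularReduction_some J h3' h4' (Ideal.mul_mem_right _ _
      (mem_maximalIdeal_iff_dvd.mpr (dvd_refl ϖ))) (Ideal.mul_mem_right _ _
      (mem_maximalIdeal_iff_dvd.mpr (dvd_refl ϖ))) h
  -- negation swaps the label
  have hneg : ∀ P, P ∉ H → -P ∉ H ∧ cls (-P) = !cls P := by
    intro P hP
    rw [hH, WeierstrassCurve.mem_nonsingularReductionSubgroup_iff] at hP
    have hPy := hfy _ _ (fh P hP) (hPeq P hP ▸ hP)
    obtain ⟨h', e⟩ := neg_eq_some_IV J hα hγ (fh P hP)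
    have hnegbad := hbadpt _ _ h'
    have hy' := hfy _ _ h' hnegbad
    rw [hPeq P hP, e, hH, WeierstrassCurve.mem_nonsingularReductionSubgroup_iff]
    refine ⟨hnegbad, ?_⟩
    simp only [hcls]
    rw [hy', hPy]
    simp only [map_sub, map_neg, map_mul]
    rw [← hϖdef, hres0, zero_mul, zero_mul, sub_zero]
    exact hflip _ (hroot P hP)
  -- same label: the sum is bad with the other label
  have hsame : ∀ P Q, P ∉ H → Q ∉ H → cls P = cls Q → P + Q ∉ H ∧ cls (P + Q) = !cls P := by
    intro P Q hP hQ hPQ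
    rw [hH, WeierstrassCurve.mem_nonsingularReductionSubgroup_iff] at hP hQ
    have hPy := hfy _ _ (fh P hP) (hPeq P hP ▸ hP)
    have hres : residue R (fy P) = residue R (fy Q) := by
      simp only [hcls, decide_eq_decide] at hPQ
      rcases hroot P hP with h | h <;> rcases hroot Q hQ with h' | h'
      · rw [h, h']
      · exact absurd (hPQ.mp h) (h' ▸ hr₁₂)
      · exact absurd (hPQ.mpr h') (h ▸ hr₁₂)
      · rw [h, h']
    obtain ⟨X, Y, h₃, hsum, hY⟩ := add_eq_some_IV J hϖ hα hβ hγ hδ hres (hsimple P hP)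
      (fh P hP) (fh Q hQ)
    have hsumbad := hbadpt _ _ h₃
    have hyY := hfy _ _ h₃ hsumbad
    rw [hPeq P hP, hPeq Q hQ, hsum, hH, WeierstrassCurve.mem_nonsingularReductionSubgroup_iff]
    refine ⟨hsumbad, ?_⟩
    simp only [hcls]
    rw [hyY, hPy, hY]
    exact hflip _ (hroot P hP)
  exact index_eq_three_of_cls H cls hneg hsame
    (x₀ := P₀) (by rwa [hH, WeierstrassCurve.mem_nonsingularReductionSubgroup_iff])

/-- **`[E(K) : E₀(K)] ∈ {1, 3}` for type `IV`** over a discrete valuation ring with perfect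
residue field (Silverman, *ATAEC*, IV.9.4 Step 5: `c = 3` or `1`).
[cite: SilvermanATAEC1994, IV.9.4 Step 5] -/
theorem index_mem_of_kodairaSymbolOfMinimal_eq_IV [PerfectField (ResidueField R)]
    (I : WeierstrassCurve R) (hI : I.kodairaSymbolOfMinimal = .IV) :
    (I.nonsingularReductionSubgroup (integers_valuationRing_valuation R K)).index = 1 ∨
      (I.nonsingularReductionSubgroup (integers_valuationRing_valuation R K)).index = 3 := by
  obtain ⟨D, h1, h2, h3, h4, h6, hb₆⟩ := exists_smul_of_kodairaSymbolOfMinimal_eq_IV I hI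
  rw [← index_nonsingularReductionSubgroup_smul I D]
  exact index_mem_of_normalForm_IV (D • I) h1 h2 h3 h4 h6 hb₆

end LocalIndex

/-! ### The discharge -/

section Discharge

open IsDedekindDomain

variable {A : Type*} [CommRing A] [IsDedekindDomain A] {K : Type*} [Field K] [Algebra A K]
  [IsFractionRing A K] (v : HeightOneSpectrum A) (W : WeierstrassCurve K)

/-- **Discharge of `localTamagawaNumber_of_kodairaSymbolAt_eq_IV`**: `c_v ∈ {1, 3}` for type
`IV` (Silverman, *ATAEC*, IV.9.4 Step 5, PDF p. 344), by the elementary argument of this file.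
[cite: SilvermanATAEC1994, IV.9.4 Step 5 (PDF p. 344)] -/
theorem localTamagawaNumber_of_kodairaSymbolAt_eq_IV_holds :
    localTamagawaNumber_of_kodairaSymbolAt_eq_IV v W := by
  intro _ _ hk
  rw [WeierstrassCurve.kodairaSymbolAt_def] at hk
  change ((W.localMinimalModel v).goodReductionSubgroup (v.adicCompletionIntegers K)).index = 1 ∨
    ((W.localMinimalModel v).goodReductionSubgroup (v.adicCompletionIntegers K)).index = 3
  have key : ∀ (M : WeierstrassCurve (v.adicCompletion K))
      [M.IsMinimal (v.adicCompletionIntegers K)],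
      (M.integralModel (v.adicCompletionIntegers K)).kodairaSymbolOfMinimal = .IV →
        (M.goodReductionSubgroup (v.adicCompletionIntegers K)).index = 1 ∨
        (M.goodReductionSubgroup (v.adicCompletionIntegers K)).index = 3 := by
    intro M _ hM
    obtain ⟨I, rfl⟩ : ∃ I : WeierstrassCurve (v.adicCompletionIntegers K),
        M = I.baseChange (v.adicCompletion K) := WeierstrassCurve.IsIntegral.integral
    rw [WeierstrassCurve.integralModel_baseChange_eq] at hM
    rw [WeierstrassCurve.goodReductionSubgroup_baseChange_eq]
    exact LocalIndex.index_mem_of_kodairaSymbolOfMinimal_eq_IV I hM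
  exact key (W.localMinimalModel v) hk

end Discharge

end Literature.NumberTheory.EllipticCurves

end
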